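import Summits.HodgeConjecture.CorCM.CurveTimesMultiquadraticCMHodge
import Literature.AlgebraicGeometry.Pohlmann1968.HodgeClassesProductSpanCMProductsPowersIntrinsic
import Literature.NumberTheory.ComplexMultiplication.SharedImaginaryQuadraticFamilies
import Literature.NumberTheory.ComplexMultiplication.CMTypeDictionaryGroupLevel
import HarnessLib

/-!
# `E × Y` versus its powers: for `E` a CM elliptic curve inside the multiquadratic CM field of a nondegenerate `Y`,
# `E × Y` has the product-span property but some `E^{a+1} × Y^{a+1}` does not (`Hg(E × Y) ⊊ Hg(E) × Hg(Y)`)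

COR-CM (cell `pub-hodgecm2`, binder seat `b25` gen 35, count-neutral claim PRODSPAN-POWERS (F16)); NEW as stated, hence
under `Summits/`.  Theorems only; no definition, no named fact, no `sorry`.  Sequel of
`CorCM/CurveTimesMultiquadraticCMHodge` (`HodgeClassesProductSpan E Y`) supplying the NEGATIVE half:

* `typeRank_glued_add_one_ne` — for `k ⊆ K` (`k` imaginary quadratic, `K` a CM field, `Φ` nondegenerate) the one-slot
  families `{Φ_k}`, `{Φ}` are NOT rank additive: `rank(Σ_k ⊔ Σ) + 1 ≠ cmFamilyRank {Φ_k} + cmFamilyRank {Φ}` — i.e.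
  `Hg(E × Y) ⊊ Hg(E) × Hg(Y)` — from the tree's
  `ComplexMultiplication.not_isNondegenerateFamily_of_shared_imaginary_quadratic` (seat b23: a shared imaginary
  quadratic field makes every family DEGENERATE) for the glued family over `Fin 1 ⊔ Fin 1`, transported to the two-block
  index set by `typeRank_preimage_eq`;
* **`exists_not_hodgeClassesProductSpan_powSucc_curve`** — hence (Moonen–Zarhin (3.1) for CM abelian varieties, the
  tree's `Pohlmann1968.exists_not_hodgeClassesProductSpan_pow_of_typeRank_lt` via `Milne1999.powFlatIso`) some power
  `E^{a+1} × Y^{a+1}` carries a rational Hodge class which is NOT a `ℂ`-combination of exterior products of Hodge classes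
  of the two factors (NO multiquadratic hypothesis needed here: any CM field `K ⊇ k`, any nondegenerate `Φ`);
* **`hodgeClassesProductSpan_and_exists_not_powSucc`** — for `K` MULTIQUADRATIC (normal, commutative Galois group of
  exponent `2`, `[K:ℚ] ≥ 4`): `HodgeClassesProductSpan E Y ∧ ∃ a, ¬ HodgeClassesProductSpan (E.powSucc a) (Y.powSucc a)`
  — the product-span property of Moonen–Zarhin is NOT inherited by powers, even for CM abelian varieties; so in
  their criterion (3.1) ("`Hg(X₁ × X₂) = Hg(X₁) × Hg(X₂)` iff the Hodge classes of ALL `X₁^k × X₂^l` are generated by those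
  of the factors") the quantification over powers cannot be dropped.  Example: `K = ℚ(ζ₂₄) = ℚ(i, √2, √3)`,
  `k ∈ {ℚ(i), ℚ(√-2), ℚ(√-3), ℚ(√-6)}`, `Φ` any nondegenerate type (e.g. residues `{1, 5, 7, 13}`).

## References
* [MoonenZarhin1999LowDim] B. Moonen, Yu. Zarhin, Math. Ann. 315 (1999) 711–733, §3 (3.1), Thm. (0.2).
* [Gordon1999HodgeAVSurvey] B. B. Gordon, *A survey of the Hodge conjecture for abelian varieties*, 7.5–7.7, §3 Theorem.
* [Deligne1982HodgeCycles] P. Deligne, *Hodge cycles on abelian varieties*, LNM 900 (1982), I Ex. 3.7 (c), §4.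
-/

noncomputable section

open CategoryTheory CategoryTheory.Limits NumberField

namespace Summit.HodgeConjecture.CorCM.Multiquadratic

open Literature.AlgebraicGeometry.Motives
open Literature.AlgebraicGeometry.Motives.AbelianVariety
open Literature.AlgebraicGeometry.HodgeTheory
open Literature.AlgebraicGeometry.ComplexMultiplication (IsCMTypeRealisation)
open Literature.AlgebraicGeometry.Pohlmann1968
open Literature.AlgebraicGeometry.Milne1999 (flatIndex)
open Literature.NumberTheory.ComplexMultiplication

open scoped Classical

section Rank

variable {k : Type} [Field k] [NumberField k] [IsCMField k]
  {K : Type} [Field K] [NumberField K] [IsCMField K]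

/-- **`Hg(E × Y) ⊊ Hg(E) × Hg(Y)`: the one-slot families `{Φ_k}`, `{Φ}` of an imaginary quadratic `k ⊆ K` and a
nondegenerate CM type `Φ` of `K` are NOT rank additive.**  The glued family over `Fin 1 ⊔ Fin 1` is degenerate (shared
imaginary quadratic field, seat b23's `not_isNondegenerateFamily_of_shared_imaginary_quadratic`), while both members
are nondegenerate; additivity would make the glued family nondegenerate. [cite: Gordon1999HodgeAVSurvey, 7.5–7.7]
[cite: MoonenZarhin1999LowDim, §3 (3.1)] -/
theorem typeRank_glued_add_one_ne (hk : Module.finrank ℚ k = 2) (j : k →+* K) (Φk : CMType k) {Φ : CMType K}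
    (hnd : IsNondegenerate Φ) :
    typeRank (ℂ ≃+* ℂ) {z : (Σ _ : Fin 1, (k →+* ℂ)) ⊕ (Σ _ : Fin 1, (K →+* ℂ)) |
        Sum.elim (· ∈ CMAlgebra.familyType (fun _ : Fin 1 => Φk)) (· ∈ CMAlgebra.familyType (fun _ : Fin 1 => Φ)) z} + 1 ≠
      CMAlgebra.cmFamilyRank (fun _ : Fin 1 => Φk) + CMAlgebra.cmFamilyRank (fun _ : Fin 1 => Φ) := by
  -- the glued family over `Fin 1 ⊔ Fin 1` (fields `Sum.elim (fun _ => k) (fun _ => K)`)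
  letI instF : ∀ i, Field (Sum.elim (fun _ : Fin 1 => k) (fun _ : Fin 1 => K) i) := fun i =>
    Sum.rec (motive := fun i => Field (Sum.elim (fun _ : Fin 1 => k) (fun _ : Fin 1 => K) i))
      (fun _ => inferInstanceAs (Field k)) (fun _ => inferInstanceAs (Field K)) i
  letI instN : ∀ i, NumberField (Sum.elim (fun _ : Fin 1 => k) (fun _ : Fin 1 => K) i) := fun i =>
    Sum.rec (motive := fun i => NumberField (Sum.elim (fun _ : Fin 1 => k) (fun _ : Fin 1 => K) i))
      (fun _ => inferInstanceAs (NumberField k)) (fun _ => inferInstanceAs (NumberField K)) i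
  haveI instC : ∀ i, IsCMField (Sum.elim (fun _ : Fin 1 => k) (fun _ : Fin 1 => K) i) := fun i =>
    Sum.rec (motive := fun i => IsCMField (Sum.elim (fun _ : Fin 1 => k) (fun _ : Fin 1 => K) i))
      (fun _ => inferInstanceAs (IsCMField k)) (fun _ => inferInstanceAs (IsCMField K)) i
  let ΦJ : ∀ i, CMType (Sum.elim (fun _ : Fin 1 => k) (fun _ : Fin 1 => K) i) := fun i =>
    Sum.rec (motive := fun i => CMType (Sum.elim (fun _ : Fin 1 => k) (fun _ : Fin 1 => K) i)) (fun _ => Φk) (fun _ => Φ) i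
  -- it is degenerate: `k` embeds in both members
  have hdeg : ¬ CMAlgebra.IsNondegenerateFamily ΦJ :=
    not_isNondegenerateFamily_of_shared_imaginary_quadratic (K := Sum.elim (fun _ : Fin 1 => k) (fun _ : Fin 1 => K)) hk
      (i₀ := Sum.inl 0) (i₁ := Sum.inr 0) (by simp) (RingHom.id k) j ΦJ
  -- its rank is the rank of the glued type
  let e : ((Σ _ : Fin 1, (k →+* ℂ)) ⊕ (Σ _ : Fin 1, (K →+* ℂ))) ≃
      (Σ i : Fin 1 ⊕ Fin 1, (Sum.elim (fun _ : Fin 1 => k) (fun _ : Fin 1 => K) i →+* ℂ)) :=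
    { toFun := Sum.elim (fun x => ⟨Sum.inl x.1, x.2⟩) (fun y => ⟨Sum.inr y.1, y.2⟩)
      invFun := fun z => Sum.rec
        (motive := fun i => (Sum.elim (fun _ : Fin 1 => k) (fun _ : Fin 1 => K) i →+* ℂ) →
          (Σ _ : Fin 1, (k →+* ℂ)) ⊕ (Σ _ : Fin 1, (K →+* ℂ)))
        (fun i s => Sum.inl ⟨i, s⟩) (fun i t => Sum.inr ⟨i, t⟩) z.1 z.2
      left_inv := fun z => by rcases z with ⟨i, s⟩ | ⟨i, t⟩ <;> rfl
      right_inv := fun z => by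
        obtain ⟨i, s⟩ := z
        rcases i with i | i <;> rfl }
  have hpre : e ⁻¹' CMAlgebra.familyType ΦJ =
      {z : (Σ _ : Fin 1, (k →+* ℂ)) ⊕ (Σ _ : Fin 1, (K →+* ℂ)) |
        Sum.elim (· ∈ CMAlgebra.familyType (fun _ : Fin 1 => Φk)) (· ∈ CMAlgebra.familyType (fun _ : Fin 1 => Φ)) z} := by
    ext z
    rcases z with ⟨i, s⟩ | ⟨i, t⟩ <;> rfl
  have hrank : typeRank (ℂ ≃+* ℂ) {z : (Σ _ : Fin 1, (k →+* ℂ)) ⊕ (Σ _ : Fin 1, (K →+* ℂ)) |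
        Sum.elim (· ∈ CMAlgebra.familyType (fun _ : Fin 1 => Φk)) (· ∈ CMAlgebra.familyType (fun _ : Fin 1 => Φ)) z} =
      CMAlgebra.cmFamilyRank ΦJ := by
    rw [← hpre, CMAlgebra.cmFamilyRank]
    refine typeRank_preimage_eq (G := ℂ ≃+* ℂ) (G' := ℂ ≃+* ℂ) (CMAlgebra.familyType ΦJ) e
      (fun τ => ⟨τ, fun z => ?_⟩) (fun τ => ⟨τ, fun z => ?_⟩) <;>
    · rcases z with ⟨i, s⟩ | ⟨i, t⟩ <;> rfl
  -- the members are nondegenerate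
  have h1 : CMAlgebra.cmFamilyRank (fun _ : Fin 1 => Φk) = 2 := by
    have h := (CMAlgebra.isNondegenerateFamily_iff_isNondegenerate (fun _ : Fin 1 => Φk)).2
      (isNondegenerate_of_finrank_eq_two Φk hk)
    rw [CMAlgebra.isNondegenerateFamily_iff] at h
    rw [h]
    simp [hk]
  have h2 : CMAlgebra.cmFamilyRank (fun _ : Fin 1 => Φ) = Module.finrank ℚ K / 2 + 1 := by
    have h := (CMAlgebra.isNondegenerateFamily_iff_isNondegenerate (fun _ : Fin 1 => Φ)).2 hnd
    rw [CMAlgebra.isNondegenerateFamily_iff] at h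
    rw [h]
    simp
  intro hadd
  apply hdeg
  rw [CMAlgebra.isNondegenerateFamily_iff, ← hrank]
  rw [h1, h2] at hadd
  have hsum : (∑ i : Fin 1 ⊕ Fin 1, Module.finrank ℚ (Sum.elim (fun _ : Fin 1 => k) (fun _ : Fin 1 => K) i)) =
      2 + Module.finrank ℚ K := by
    have hk' : ∀ x : Fin 1, Module.finrank ℚ (Sum.elim (fun _ : Fin 1 => k) (fun _ : Fin 1 => K) (Sum.inl x)) = 2 :=
      fun _ => hk
    have hK' : ∀ x : Fin 1, Module.finrank ℚ (Sum.elim (fun _ : Fin 1 => k) (fun _ : Fin 1 => K) (Sum.inr x)) =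
        Module.finrank ℚ K := fun _ => rfl
    rw [Fintype.sum_sum_type, Fintype.sum_unique, Fintype.sum_unique, hk', hK']
  rw [hsum]
  omega

end Rank

section Powers

variable {k : Type} [Field k] [NumberField k] [IsCMField k]
  {K : Type} [Field K] [NumberField K] [IsCMField K]
  {Φk : CMType k} {Φ : CMType K}
  {E Y : AbelianVariety ℂ} {ιE : 𝓞 k →+* End E} {ιY : 𝓞 K →+* End Y}
  {θE : k →+* Module.End ℂ (complexBetti E.X 1)} {θY : K →+* Module.End ℂ (complexBetti Y.X 1)}

/-- `X ∼ ⨁_{Fin 1} X`. [cite: MumfordAV1970, §19 (products of abelian varieties)] -/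
private theorem isIsogenous_biproduct_fin_one' (X : AbelianVariety ℂ) : IsIsogenous X (⨁ fun _ : Fin 1 => X) :=
  isIsogenous_powSucc_biproduct X 0

/-- **Some `E^{a+1} × Y^{a+1}` carries a Hodge class outside the span of exterior products** — for EVERY CM elliptic
curve `E` (CM field `k`) and EVERY nondegenerate `Y` with CM by a CM field `K ⊇ k` (any `K`): the pair is not rank
additive (`typeRank_glued_add_one_ne`), so Moonen–Zarhin (3.1) for CM abelian varieties
(`Pohlmann1968.typeRank_sum_add_one_eq_iff_forall_hodgeClassesProductSpan_pow` with `Milne1999.powFlatIso`) produces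
the power. [cite: MoonenZarhin1999LowDim, §3 (3.1)] [cite: Gordon1999HodgeAVSurvey, 7.5 (1) ⟹ (3)] -/
theorem exists_not_hodgeClassesProductSpan_powSucc_curve (hk : Module.finrank ℚ k = 2) (j : k →+* K)
    (hnd : IsNondegenerate Φ) (hE : IsCMTypeRealisation Φk E ιE θE) (hY : IsCMTypeRealisation Φ Y ιY θY) :
    ∃ a : ℕ, ¬ HodgeClassesProductSpan (E.powSucc a) (Y.powSucc a) := by
  haveI : Nonempty (Σ _ : Fin 1, (k →+* ℂ)) := by
    obtain ⟨s⟩ := (inferInstance : Nonempty (k →+* ℂ)); exact ⟨⟨0, s⟩⟩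
  haveI : Nonempty (Σ _ : Fin 1, (K →+* ℂ)) := by
    obtain ⟨t⟩ := (inferInstance : Nonempty (K →+* ℂ)); exact ⟨⟨0, t⟩⟩
  have hlt := lt_of_le_of_ne
    (typeRank_sum_add_one_le (CMAlgebra.isCMTypeWith_familyType (fun _ : Fin 1 => Φk))
      (CMAlgebra.isCMTypeWith_familyType (fun _ : Fin 1 => Φ)))
    (typeRank_glued_add_one_ne hk j Φk hnd)
  obtain ⟨a, ha⟩ := exists_not_hodgeClassesProductSpan_pow_of_typeRank_lt (K := fun _ : Fin 1 => k)
    (K' := fun _ : Fin 1 => K) (Φ := fun _ => Φk) (Φ' := fun _ => Φ) (A := fun _ => E) (A' := fun _ => Y)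
    (ι := fun _ => ιE) (ι' := fun _ => ιY) (θ := fun _ => θE) (θ' := fun _ => θY) (fun _ => hE) (fun _ => hY) hlt
  exact ⟨a, fun h => ha (h.of_isIsogenous'
    (isIsogenous_powSucc_biproduct_flatIndex (A := fun _ : Fin 1 => E) (isIsogenous_biproduct_fin_one' E) a)
    (isIsogenous_powSucc_biproduct_flatIndex (A := fun _ : Fin 1 => Y) (isIsogenous_biproduct_fin_one' Y) a))⟩


/-- **`Hg(E × Y) ⊊ Hg(E) × Hg(Y)` read on Mumford–Tate ranks**: `dim MT(H¹(E × Y)) + 1 < dim MT(H¹ E) + dim MT(H¹ Y)`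
for every CM elliptic curve `E` (CM field `k`) and every nondegenerate `Y` with CM by a CM field `K ⊇ k` (Deligne's
Ex. 3.7 (c) on the varieties: `Pohlmann1968.mtRank_hodge_one_eq_typeRank_sum_of_isIsogenous_prod`).
[cite: Deligne1982HodgeCycles, I Ex. 3.7 (c)] [cite: Gordon1999HodgeAVSurvey, 7.5–7.7] -/
theorem mtRank_hodge_one_curve_prod_add_one_lt [HodgeTensorFacts.{0, 0}] (hk : Module.finrank ℚ k = 2) (j : k →+* K)
    (hnd : IsNondegenerate Φ) (hE : IsCMTypeRealisation Φk E ιE θE) (hY : IsCMTypeRealisation Φ Y ιY θY)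
    {kX kY kXY : ℕ} (hX : IsSmoothProjective kX E.X) (hY' : IsSmoothProjective kY Y.X)
    (hXY : IsSmoothProjective kXY (E.prod Y).X) :
    haveI := BettiUniverse.finite hX 1
    haveI := BettiUniverse.finite hY' 1
    haveI := BettiUniverse.finite hXY 1
    (BettiUniverse.hodge exists_isReal_hodgeModel_holds hXY 1).mtRank + 1 <
      (BettiUniverse.hodge exists_isReal_hodgeModel_holds hX 1).mtRank +
        (BettiUniverse.hodge exists_isReal_hodgeModel_holds hY' 1).mtRank := by
  have hXi := isIsogenous_biproduct_fin_one' E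
  have hYi := isIsogenous_biproduct_fin_one' Y
  rw [mtRank_hodge_one_eq_typeRank_sum_of_isIsogenous_prod (K := fun _ : Fin 1 => k) (K' := fun _ : Fin 1 => K)
      (Φ := fun _ => Φk) (Φ' := fun _ => Φ) (A := fun _ => E) (A' := fun _ => Y) (ι := fun _ => ιE)
      (ι' := fun _ => ιY) (θ := fun _ => θE) (θ' := fun _ => θY) (fun _ => hE) (fun _ => hY) hXY (hXi.prod hYi),
    mtRank_hodge_one_eq_cmFamilyRank_of_isIsogenous_biproduct_fin (Φ := fun _ : Fin 1 => Φk) (fun _ => hE) hX hXi,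
    mtRank_hodge_one_eq_cmFamilyRank_of_isIsogenous_biproduct_fin (Φ := fun _ : Fin 1 => Φ) (fun _ => hY) hY' hYi]
  exact lt_of_le_of_ne (typeRank_sum_add_one_le_cmFamilyRank _ _) (typeRank_glued_add_one_ne hk j Φk hnd)

variable [Normal ℚ K]

/-- **Moonen–Zarhin's product-span property is NOT inherited by powers, even for CM abelian varieties.**  For `K` a
MULTIQUADRATIC CM field (normal over `ℚ`, commutative Galois group of exponent `2`, `[K:ℚ] ≥ 4`), `k ⊆ K` imaginary
quadratic, `Φ` nondegenerate, `E`, `Y` realisations: every Hodge class on `E × Y` is a combination of exterior products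
(`hodgeClassesProductSpan_curve_multiquadratic`), yet some `E^{a+1} × Y^{a+1}` carries one which is not.  So in (3.1)
the quantification over ALL powers `X₁^k × X₂^l` cannot be dropped.  Example: `K = ℚ(ζ₂₄) = ℚ(i, √2, √3)`.
[cite: MoonenZarhin1999LowDim, §3 (3.1) and Thm. (0.2)] [cite: Kubota1965, §4 Lemma 2] -/
theorem hodgeClassesProductSpan_and_exists_not_powSucc (hk : Module.finrank ℚ k = 2) (j : k →+* K)
    (hcomm : ∀ g h : K ≃ₐ[ℚ] K, g * h = h * g) (hexp : ∀ g : K ≃ₐ[ℚ] K, g * g = 1) (h4 : 4 ≤ Module.finrank ℚ K)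
    (hnd : IsNondegenerate Φ) (hE : IsCMTypeRealisation Φk E ιE θE) (hY : IsCMTypeRealisation Φ Y ιY θY) :
    HodgeClassesProductSpan E Y ∧ ∃ a : ℕ, ¬ HodgeClassesProductSpan (E.powSucc a) (Y.powSucc a) :=
  ⟨hodgeClassesProductSpan_curve_multiquadratic hk j hcomm hexp h4 hnd hE hY,
    exists_not_hodgeClassesProductSpan_powSucc_curve hk j hnd hE hY⟩

end Powers

end Summit.HodgeConjecture.CorCM.Multiquadratic

end
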